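import Literature.NumberTheory.LFunctions.ZetaCertifiedEvaluation
import Literature.NumberTheory.LFunctions.MertensConjectureDisproofAssembly
import HarnessLib

/-!
# Checkers for a sparse certificate of the disproof of the Mertens conjecture

Trunk T-ANT (NumberTheory/LFunctions; summit `RiemannHypothesis`, inventory id rh.S22).
Executable checkers, with soundness theorems, for the arithmetic hypotheses of
`Literature.NumberTheory.LFunctions.not_mertens_conjecture_of_twisted_certificate` (`MertensConjectureDisproofAssembly.lean`),
and the assembled statement `not_mertens_conjecture_of_checks`: given *claimed* data — a scale
`S`, brackets `[A_j/S, (A_j + w)/S]` for the first `n` zeros of `ζ` on the critical line, a height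
`T = Tₙ/T_d` between the `n`-th and the `(n+1)`-st zero, a point `y = y_N/y_D`, Euler–Maclaurin
parameters, a piece list along `[½, 2] × {T}` and per-block lower bounds — the checkers re-evaluate
everything *inside Lean* with the certified evaluator `Literature.NumberTheory.LFunctions.ZetaNumerics.zetaBox`
(`ZetaCertifiedEvaluation.lean`) in the multi-precision interval arithmetic of
`MultiPrecisionInterval.lean`, and the soundness theorems turn `check… = true` into the
real-number statements consumed by the assembly:

* `checkBlock` / `checkBlock_sound` — for a block of consecutive brackets: the twisted sign test
  `Re (ζ(½+ia_j) · conj ζ(½+ib_j)) < 0` (a zero in each bracket, `MertensZeroCertificate.lean`) and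
  a lower bound for the partial sum of `2 Re [k(γ_j/T) e^{iγ_j y} / ((½+iγ_j) D_j)]` valid for all
  `γ_j` in the brackets and all `D_j` within `(b_j − a_j) · 4(b_j+4)³` of the secant slope of `ζ`
  across the bracket (which encloses `ζ'(½+iγ_j)`, `norm_deriv_riemannZeta_sub_slope_le`), with the
  Jurkat–Peyerimhoff weight `k = jurkatPeyerimhoffKernel`;
* `checkPieces` / `checkPieces_sound` — a certified piece list (`Literature.Analysis.Complex.HPieces`) for `ζ`
  along the top edge `[x₀, 2] × {T}` from enclosures of `ζ` on boxes;
* `checkCount` / `checkCount_sound` — the inequality pinning `N(T) = n` from the Stirling main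
  term of `θ` (`zetaZeroCount_eq_of_hpieces_stirling`);
* `checkShape` / `checkShape_sound` — ordering, separation and size conditions on the brackets;
* `blocksChain`, `blocks_sound`, **`not_mertens_conjecture_of_checks`** — blocks tiling `[0, n)`
  whose claimed bounds sum to more than `2⁶⁴` (`Σ_j 2 Re F_y(γ_j) > 1`), a checked top edge, count
  and shape give `Literature.NumberTheory.LFunctions.not_mertens_conjecture`; `odlyzko_te_riele_limsup_of_checks` — the same
  with the bound `1.06`.

The design (data claimed externally, verified here; blocks evaluated by `native_decide` in
separate small files, `MertensSparseCertificate/Block*.lean`, `…/Top.lean`, glued in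
`RHWave0MertensProofs.lean`) follows the tree's `LiouvilleSieve/Chunk*.lean`. The data it is run
on (`MertensSparseCertificateData.lean`: `n = 500` zeros, `T = 812`, an 86-digit `y` with
`h_{K_T}(y) = 1.0642…`) are *not* those printed by Odlyzko–te Riele (2000 zeros, `T ≈ 2515.3`,
65-digit `y`, `h = 1.0615`) but a sparser certificate found for this formalisation by their method
(LLL reduction of the inhomogeneous Diophantine approximation lattice, [OdlyzkoTeRiele1985, §3])
with far fewer zeros, which is cheaper to verify and still gives `h_{K_T}(y) > 1.06`, hence
`limsup M(x) x^{-1/2} > 1.06` and the falsity of the Mertens conjecture by the theorem of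
[OdlyzkoTeRiele1985, p. 144]. The checkers are independent of those particular numbers.

## References

* A. M. Odlyzko, H. J. J. te Riele, *Disproof of the Mertens conjecture*, J. reine angew. Math.
  357 (1985), 138–160: §3 (lattice construction of `y`), §4 (the numerical verification: zeros by
  Euler–Maclaurin §4.2, the sum `h_K` §4.3, Table 3 p. 155). [OdlyzkoTeRiele1985]
* R. P. Brent, *On the zeros of the Riemann zeta function in the critical strip*, Math. Comp. 33
  (1979), §3 (locating zeros by sign changes). [Brent1979]
* H. M. Edwards, *Riemann's Zeta Function* (1974), §6.6 (Backlund's exact count of `N(T)`).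
  [EdwardsZeta1974]
-/

open Complex Literature.Analysis.ValidatedNumerics.NumericsMP Literature.NumberTheory.LFunctions

namespace Literature.NumberTheory.LFunctions.ZetaNumerics.SparseCert

/-! ## Certificate data and its real-number meaning -/

/-- The claimed data of a sparse certificate: scale `S`; number of zeros `n`; scaled left
endpoints `A_j` (`a_j = A_j/S`) and the common scaled bracket width `w` (`b_j = (A_j + w)/S`);
the height `T = Tn/Td`; the point `y = yN/yD`. [cite: OdlyzkoTeRiele1985, §4.2–4.3] -/
structure Cert where
  /-- scale (a power of two in practice) -/
  S : ℕ
  /-- number of brackets (zeros below `T`) -/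
  n : ℕ
  /-- scaled left endpoints of the brackets -/
  A : Array ℤ
  /-- scaled width of every bracket -/
  w : ℕ
  /-- numerator of the height `T` -/
  Tn : ℕ
  /-- denominator of the height `T` -/
  Td : ℕ
  /-- numerator of `y` -/
  yN : ℤ
  /-- denominator of `y` -/
  yD : ℕ

/-- Euler–Maclaurin / Taylor parameters for `mkTables` (truncation `N`, order `ν`, guard bits,
series lengths). [folklore] -/
structure EMParams where
  /-- truncation point -/
  N : ℕ
  /-- number of Bernoulli terms -/
  nu : ℕ
  /-- guard bits for the tables -/
  guard : ℕ
  /-- terms for `log` -/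
  Klog : ℕ
  /-- terms for `π` -/
  Kpi : ℕ
  /-- terms for `exp` -/
  Kexp : ℕ
  /-- halvings for `exp` -/
  kexp : ℕ
  /-- terms for `expI` -/
  KI : ℕ
  /-- halvings for `expI` -/
  kI : ℕ

namespace Cert

variable (c : Cert)

/-- Left endpoint `a_j = A_j / S` of the `j`-th bracket. [folklore] -/
noncomputable def a (j : ℕ) : ℝ := ((c.A.getD j 0 : ℤ) : ℝ) / c.S

/-- Right endpoint `b_j = (A_j + w) / S` of the `j`-th bracket. [folklore] -/
noncomputable def b (j : ℕ) : ℝ := ((c.A.getD j 0 + c.w : ℤ) : ℝ) / c.S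

/-- The height `T = Tn / Td`. [folklore] -/
noncomputable def T : ℝ := (c.Tn : ℝ) / c.Td

/-- The point `y = yN / yD`. [folklore] -/
noncomputable def y : ℝ := (c.yN : ℝ) / c.yD

/-- The secant slope of `ζ` across the `j`-th bracket, `(ζ(½+ib_j) − ζ(½+ia_j)) / ((b_j − a_j) i)`
(an approximation of `ζ'(½+iγ_j)`). [folklore] -/
noncomputable def slope (j : ℕ) : ℂ :=
  (riemannZeta (1 / 2 + c.b j * I) - riemannZeta (1 / 2 + c.a j * I)) / ((c.b j - c.a j : ℝ) * I)

/-- The admissible distance `(b_j − a_j) · 4 (b_j + 4)³` of the parameter `D_j` from the slope.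
[folklore] -/
noncomputable def δ (j : ℕ) : ℝ := (c.b j - c.a j) * (4 * (c.b j + 4) ^ 3)

/-- The summand `2 Re [k(γ/T) e^{iγy} / ((½ + iγ) D)]` with the Jurkat–Peyerimhoff weight.
[cite: OdlyzkoTeRiele1985, Theorem p. 144 and (4.1) p. 150] -/
noncomputable def F (γ : ℝ) (D : ℂ) : ℝ :=
  2 * ((jurkatPeyerimhoffKernel (γ / c.T) : ℂ) * cexp (I * (γ * c.y)) / ((1 / 2 + γ * I) * D)).re

end Cert

/-- The tables of the evaluator at scale `S` with parameters `p`. [folklore] -/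
def EMParams.mkTab (p : EMParams) (S : ℕ) : Option Tables :=
  mkTables S p.N p.nu p.guard p.Klog p.Kpi p.Kexp p.kexp p.KI p.kI

/-- The tables of the evaluator at the certificate's scale. [folklore] -/
def Cert.mkTab (c : Cert) (p : EMParams) : Option Tables := p.mkTab c.S

/-- Tables built by `EMParams.mkTab` are valid and have the requested scale. [folklore] -/
lemma EMParams.mkTab_spec {p : EMParams} {S : ℕ} {T : Tables} (h : p.mkTab S = some T) :
    T.Valid ∧ T.S = S := by
  refine ⟨mkTables_valid h, ?_⟩
  unfold EMParams.mkTab mkTables at h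
  simp only at h
  split_ifs at h
  split at h
  · simp only [Option.some.injEq] at h
    subst h; rfl
  · simp at h

/-! ## The Jurkat–Peyerimhoff weight on an interval -/

/-- Enclosure of `g(u) = (1 − u) cos(πu) + sin(πu)/π` for `u` in `uI ⊆ [0, 1]`. [cite: OdlyzkoTeRiele1985, (4.1) p. 150] -/
def kernelBox (S KI kI : ℕ) (piI uI : MI) : Option MI :=
  match MC.expI S KI kI piI (MI.mul S piI uI) with
  | none => none
  | some cs =>
    match MI.divPos S cs.im piI with
    | none => none
    | some sp => some ((MI.mul S ((MI.ofInt S 1).sub uI) cs.re).add sp)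

/-- Soundness of `kernelBox`. [cite: OdlyzkoTeRiele1985, (4.1) p. 150] -/
theorem mem_kernelBox {S KI kI : ℕ} (hS : 0 < S) {piI uI K : MI} (hpi : MI.mem S Real.pi piI)
    {u : ℝ} (hu : MI.mem S u uI) (hu0 : 0 ≤ u) (hu1 : u ≤ 1)
    (h : kernelBox S KI kI piI uI = some K) : MI.mem S (jurkatPeyerimhoffKernel u) K := by
  unfold kernelBox at h
  split at h
  · simp at h
  · rename_i cs hcs
    split at h
    · simp at h
    · rename_i sp hsp
      simp only [Option.some.injEq] at h
      subst h
      have hθ : MI.mem S (Real.pi * u) (MI.mul S piI uI) := MI.mem_mul hS hpi hu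
      have he := MC.mem_expI hS hpi hcs hθ
      have hre : MI.mem S (Real.cos (Real.pi * u)) cs.re := by
        have := he.1
        rwa [show ((↑(Real.pi * u) : ℂ) * Complex.I) = ↑(Real.pi * u) * Complex.I from rfl,
          Complex.exp_ofReal_mul_I_re] at this
      have him : MI.mem S (Real.sin (Real.pi * u)) cs.im := by
        have := he.2
        rwa [Complex.exp_ofReal_mul_I_im] at this
      have hsp' := MI.mem_divPos hS hsp him hpi
      have h1u : MI.mem S (1 - u) ((MI.ofInt S 1).sub uI) := by
        simpa using MI.mem_sub (MI.mem_ofInt S 1) hu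
      have hprod := MI.mem_mul hS h1u hre
      have hsum := MI.mem_add hprod hsp'
      have habs : |u| = u := abs_of_nonneg hu0
      unfold jurkatPeyerimhoffKernel
      rw [if_pos (by rw [habs]; exact hu1), habs]
      convert hsum using 1
      rw [inv_mul_eq_div]

/-! ## One bracket: twisted sign test and the summand box -/

/-- `½ + it = ⟨½, t⟩`. [folklore] -/
lemma half_add_mul_I (t : ℝ) : (1 / 2 : ℂ) + t * I = ⟨1 / 2, t⟩ :=
  Complex.ext (by simp) (by simp)

/-- The box of `½ + it` for the scaled thin `t = A/S`. [folklore] -/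
def lineBox (S : ℕ) (A : ℤ) : MC := ⟨MI.ofFrac S 1 2, ⟨A, A⟩⟩

/-- [folklore] -/
lemma mem_half {S : ℕ} : MI.mem S (1 / 2 : ℝ) (MI.ofFrac S 1 2) := by
  have := MI.mem_ofFrac S 1 (q := 2) (by norm_num)
  simpa using this

/-- [folklore] -/
lemma mem_lineBox {S : ℕ} (hS : 0 < S) (A : ℤ) :
    MC.mem S (1 / 2 + (((A : ℝ) / S : ℝ) : ℂ) * I) (lineBox S A) := by
  rw [half_add_mul_I]
  exact MC.mem_mk' mem_half (MI.mem_ofScaled hS A)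

/-- Membership in a scaled interval from real inequalities. [folklore] -/
lemma mem_of_le_le {S : ℕ} (hS : 0 < S) {A B : ℤ} {x : ℝ} (h1 : (A : ℝ) / S ≤ x)
    (h2 : x ≤ (B : ℝ) / S) : MI.mem S x ⟨A, B⟩ := by
  have hSr : (0 : ℝ) < S := by exact_mod_cast hS
  exact ⟨(div_le_iff₀ hSr).1 h1, (le_div_iff₀ hSr).1 h2⟩

/-- The summand box of the `j`-th bracket (and the twisted sign test as a side condition):
`none` unless `0 < A_j`, `b_j < T`, both evaluations of `ζ` succeed, the twisted sign test
`hi (Re (Z_a · conj Z_b)) < 0` passes (the product taken exactly, at scale `S²`, since the two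
values are far below the resolution `1/S`) and all interval operations succeed; otherwise an interval
containing `2 Re [k(γ/T) e^{iγy} / ((½+iγ) D)]` for every `γ ∈ [a_j, b_j]` and every `D` within
`δ_j` of the secant slope. [cite: OdlyzkoTeRiele1985, §4.3 p. 153] -/
def termBox (c : Cert) (tab : Tables) (j : ℕ) : Option MI :=
  let S := c.S
  let A := c.A.getD j 0
  let B := A + c.w
  if 0 < A ∧ B * c.Td < c.Tn * S then
    match zetaBox tab (lineBox S A), zetaBox tab (lineBox S B) with
    | some ZA, some ZB =>
      if (MC.mul 1 ZA ZB.conj).re.hi < 0 then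
        let rad : ℤ := Literature.Analysis.ValidatedNumerics.Numerics.cdiv (4 * (c.w : ℤ) * (B + 4 * S) ^ 3) ((S : ℤ) ^ 3)
        let Dbox : MC := ((((ZB.sub ZA).mulNegI).mulInt S).divNat c.w).widen rad
        let γI : MI := ⟨A, B⟩
        let uI : MI := (γI.mulInt c.Td).divNat c.Tn
        match kernelBox S tab.KI tab.kI tab.piI uI,
          MC.expI S tab.KI tab.kI tab.piI ((γI.mulInt c.yN).divNat c.yD) with
        | some kB, some eB =>
          match MC.divBox S (eB.mulMI S kB) (MC.mul S ⟨MI.ofFrac S 1 2, γI⟩ Dbox) with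
          | some q => some (q.re.mulInt 2)
          | none => none
        | _, _ => none
      else none
    | _, _ => none
  else none

section TermSound

variable {c : Cert} {tab : Tables}

/-- A box at scale `S` is a box at scale `1` for the scaled number. [folklore] -/
lemma mem_one_smul {S : ℕ} {z : ℂ} {A : MC} (h : MC.mem S z A) : MC.mem 1 (z * S) A := by
  obtain ⟨⟨h1, h2⟩, ⟨h3, h4⟩⟩ := h
  refine ⟨⟨?_, ?_⟩, ⟨?_, ?_⟩⟩ <;> simp only [Nat.cast_one, mul_one, mul_re, mul_im, natCast_re,
    natCast_im, mul_zero, sub_zero, zero_add] <;> linarith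

/-- The secant slope rewritten without division by `i`. [folklore] -/
lemma slope_eq (hS : 0 < c.S) (hw : 0 < c.w) (j : ℕ) :
    c.slope j = (riemannZeta (1 / 2 + c.b j * I) - riemannZeta (1 / 2 + c.a j * I)) * -I *
      ((c.S : ℤ) : ℂ) / (c.w : ℕ) := by
  have hSr : (c.S : ℂ) ≠ 0 := by exact_mod_cast hS.ne'
  have hwr : ((c.w : ℕ) : ℂ) ≠ 0 := by exact_mod_cast hw.ne'
  have hba : ((c.b j - c.a j : ℝ) : ℂ) = (c.w : ℂ) / (c.S : ℂ) := by
    simp only [Cert.a, Cert.b]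
    push_cast
    field_simp
    ring
  rw [Cert.slope, hba]
  field_simp
  rw [I_sq]
  push_cast
  ring

/-- **Soundness of `termBox`.** [cite: OdlyzkoTeRiele1985, §4.3 p. 153] -/
theorem termBox_sound (hT : tab.Valid) (hS : tab.S = c.S) (hw : 0 < c.w) (hTn : 0 < c.Tn)
    (hTd : 0 < c.Td) (hyD : 0 < c.yD) {j : ℕ} {tI : MI} (h : termBox c tab j = some tI) :
    (riemannZeta (1 / 2 + c.a j * I) * (starRingEnd ℂ) (riemannZeta (1 / 2 + c.b j * I))).re < 0 ∧
    ∀ (γ : ℝ) (D : ℂ), c.a j ≤ γ → γ ≤ c.b j → ‖D - c.slope j‖ ≤ c.δ j →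
      MI.mem c.S (c.F γ D) tI := by
  have hS0 : 0 < c.S := hS ▸ hT.S_pos
  have hSr : (0 : ℝ) < c.S := by exact_mod_cast hS0
  unfold termBox at h
  simp only at h
  split_ifs at h with hAB
  · split at h
    · rename_i ZA ZB hZA hZB
      split_ifs at h with hsgn
      split at h
      · rename_i kB eB hkB heB
        split at h
        · rename_i q hq
          simp only [Option.some.injEq] at h
          subst h
          -- the two values of ζ
          have hsa : MC.mem tab.S (1 / 2 + (c.a j : ℂ) * I) (lineBox c.S (c.A.getD j 0)) := by
            rw [hS]; exact mem_lineBox hS0 _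
          have hsb : MC.mem tab.S (1 / 2 + (c.b j : ℂ) * I) (lineBox c.S (c.A.getD j 0 + c.w)) := by
            rw [hS]
            have := mem_lineBox hS0 (c.A.getD j 0 + (c.w : ℤ))
            simpa [Cert.b] using this
          have hne : ∀ t : ℝ, (1 / 2 : ℂ) + t * I ≠ 1 := fun t h1 ↦ by
            have := congrArg Complex.re h1
            norm_num at this
          have hZa := mem_zetaBox hT hsa (hne _) hZA
          have hZb := mem_zetaBox hT hsb (hne _) hZB
          rw [hS] at hZa hZb
          refine ⟨?_, fun γ D hγa hγb hD ↦ ?_⟩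
          · -- twisted sign test (exact product of the scaled values)
            have hm := MC.mem_mul Nat.one_pos (mem_one_smul hZa) (MC.mem_conj (mem_one_smul hZb))
            have hneg := MI.neg_of_hi_neg hm.1 hsgn
            have e : (riemannZeta (1 / 2 + (c.a j : ℂ) * I) * (c.S : ℂ) *
                (starRingEnd ℂ) (riemannZeta (1 / 2 + (c.b j : ℂ) * I) * (c.S : ℂ))).re =
                (riemannZeta (1 / 2 + (c.a j : ℂ) * I) *
                  (starRingEnd ℂ) (riemannZeta (1 / 2 + (c.b j : ℂ) * I))).re * ((c.S : ℝ) * c.S) := by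
              rw [map_mul, Complex.conj_natCast]
              have : ∀ u v : ℂ, (u * (c.S : ℂ) * (v * (c.S : ℂ))).re = (u * v).re * ((c.S : ℝ) * c.S) := by
                intro u v
                simp only [mul_re, natCast_re, natCast_im, mul_zero, sub_zero, mul_im, zero_add]
                ring
              exact this _ _
            rw [e] at hneg
            exact neg_of_mul_neg_left hneg (by positivity)
          · -- the summand
            have hγ : MI.mem c.S γ ⟨c.A.getD j 0, c.A.getD j 0 + c.w⟩ := mem_of_le_le hS0 hγa hγb
            have hApos : (0 : ℝ) < c.A.getD j 0 := by exact_mod_cast hAB.1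
            have hγ0 : 0 < γ := lt_of_lt_of_le (div_pos hApos hSr) hγa
            have hTnr : (0 : ℝ) < c.Tn := by exact_mod_cast hTn
            have hTdr : (0 : ℝ) < c.Td := by exact_mod_cast hTd
            have hTpos : 0 < c.T := div_pos hTnr hTdr
            have hbT : c.b j < c.T := by
              have h1 : (((c.A.getD j 0 + c.w) * c.Td : ℤ) : ℝ) < ((c.Tn * c.S : ℕ) : ℝ) := by
                exact_mod_cast hAB.2
              simp only [Cert.b, Cert.T]
              push_cast at h1 ⊢
              rw [div_lt_div_iff₀ hSr hTdr]
              linarith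
            -- u = γ / T
            have hu : MI.mem c.S (γ / c.T)
                ((MI.mulInt ⟨c.A.getD j 0, c.A.getD j 0 + c.w⟩ c.Td).divNat c.Tn) := by
              have := MI.mem_divNat (MI.mem_mulInt hγ (c.Td : ℤ)) hTn
              push_cast at this
              rwa [Cert.T, div_div_eq_mul_div]
            have hu0 : 0 ≤ γ / c.T := div_nonneg hγ0.le hTpos.le
            have hu1 : γ / c.T ≤ 1 := by
              rw [div_le_one hTpos]
              linarith
            have hk := mem_kernelBox hS0 (hS ▸ hT.mem_pi) hu hu0 hu1 hkB
            -- e^{iγy}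
            have hθ : MI.mem c.S (γ * c.y)
                ((MI.mulInt ⟨c.A.getD j 0, c.A.getD j 0 + c.w⟩ c.yN).divNat c.yD) := by
              have := MI.mem_divNat (MI.mem_mulInt hγ c.yN) hyD
              rwa [Cert.y, ← mul_div_assoc]
            have he := MC.mem_expI hS0 (hS ▸ hT.mem_pi) heB hθ
            -- numerator and denominator
            have hnum := MC.mem_mulMI hS0 he hk
            have hhalfγ : MC.mem c.S (1 / 2 + (γ : ℂ) * I)
                ⟨MI.ofFrac c.S 1 2, ⟨c.A.getD j 0, c.A.getD j 0 + c.w⟩⟩ := by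
              rw [half_add_mul_I]; exact MC.mem_mk' mem_half hγ
            -- the slope and D
            have hslope : MC.mem c.S (c.slope j)
                ((((ZB.sub ZA).mulNegI).mulInt c.S).divNat c.w) := by
              have h1 := MC.mem_divNat (MC.mem_mulInt (MC.mem_mulNegI (MC.mem_sub hZb hZa))
                (c.S : ℤ)) hw
              rw [slope_eq hS0 hw]
              exact h1
            have hDm : MC.mem c.S D (((((ZB.sub ZA).mulNegI).mulInt c.S).divNat c.w).widen
                (Literature.Analysis.ValidatedNumerics.Numerics.cdiv (4 * (c.w : ℤ) * (c.A.getD j 0 + c.w + 4 * c.S) ^ 3) ((c.S : ℤ) ^ 3))) := by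
              refine MC.mem_widen hslope ?_
              have hS3 : (0 : ℤ) < (c.S : ℤ) ^ 3 := by positivity
              refine le_trans ?_ (Literature.Analysis.ValidatedNumerics.Numerics.div_le_cdiv hS3)
              have hδ : c.δ j * c.S = ((4 * (c.w : ℤ) * (c.A.getD j 0 + c.w + 4 * c.S) ^ 3 : ℤ) : ℝ) /
                  (((c.S : ℤ) ^ 3 : ℤ) : ℝ) := by
                simp only [Cert.δ, Cert.a, Cert.b]
                push_cast
                field_simp
                ring
              rw [← hδ]
              exact mul_le_mul_of_nonneg_right hD hSr.le
            have hden := MC.mem_mul hS0 hhalfγ hDm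
            have hq' := MC.mem_divBox hS0 hq hnum hden
            have hre := MI.mem_mulInt hq'.1 2
            -- identify with F
            simp only [Cert.F]
            convert hre using 1
            have e1 : cexp (I * ((γ : ℂ) * (c.y : ℂ))) = Complex.exp (((γ * c.y : ℝ) : ℂ) * I) := by
              push_cast; ring_nf
            rw [e1]
            push_cast
            ring
        · simp at h
      · simp at h
    · simp at h

end TermSound

/-! ## Blocks of brackets -/

/-- The sum of the summand boxes of the brackets `i₀, …, i₀ + k − 1` (`none` if any fails).
[cite: OdlyzkoTeRiele1985, §4.3 p. 153] -/
def blockSum (c : Cert) (tab : Tables) (i₀ : ℕ) : ℕ → Option MI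
  | 0 => some (MI.ofInt c.S 0)
  | k + 1 =>
    match blockSum c tab i₀ k, termBox c tab (i₀ + k) with
    | some s, some t => some (s.add t)
    | _, _ => none

/-- **Block checker.** Build the tables at the certificate's scale, sum the summand boxes of the
brackets `i₀ ≤ j < i₀ + len` (each passing the twisted sign test), and compare the lower endpoint
with the claimed bound `L · 2⁻⁶⁴`. [cite: OdlyzkoTeRiele1985, §4.3 p. 153] -/
def checkBlock (c : Cert) (p : EMParams) (i₀ len : ℕ) (L : ℤ) : Bool :=
  match c.mkTab p with
  | none => false
  | some tab =>
    match blockSum c tab i₀ len with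
    | none => false
    | some s => decide (L * (c.S : ℤ) ≤ s.lo * 2 ^ 64)

section BlockSound

variable {c : Cert} {tab : Tables}

/-- Soundness of `blockSum`. [cite: OdlyzkoTeRiele1985, §4.3 p. 153] -/
theorem blockSum_sound (hT : tab.Valid) (hS : tab.S = c.S) (hw : 0 < c.w) (hTn : 0 < c.Tn)
    (hTd : 0 < c.Td) (hyD : 0 < c.yD) (i₀ : ℕ) :
    ∀ (k : ℕ) {s : MI}, blockSum c tab i₀ k = some s →
      (∀ j, i₀ ≤ j → j < i₀ + k →
        (riemannZeta (1 / 2 + c.a j * I) *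
          (starRingEnd ℂ) (riemannZeta (1 / 2 + c.b j * I))).re < 0) ∧
      ∀ (γ : ℕ → ℝ) (D : ℕ → ℂ), (∀ j, i₀ ≤ j → j < i₀ + k → c.a j ≤ γ j ∧ γ j ≤ c.b j) →
        (∀ j, i₀ ≤ j → j < i₀ + k → ‖D j - c.slope j‖ ≤ c.δ j) →
        MI.mem c.S (∑ i ∈ Finset.range k, c.F (γ (i₀ + i)) (D (i₀ + i))) s
  | 0, s, h => by
    simp only [blockSum, Option.some.injEq] at h
    subst h
    refine ⟨fun j h1 h2 ↦ by omega, fun γ D _ _ ↦ ?_⟩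
    simpa using MI.mem_ofInt c.S 0
  | k + 1, s, h => by
    simp only [blockSum] at h
    split at h
    · rename_i s' t hs' ht
      simp only [Option.some.injEq] at h
      subst h
      obtain ⟨ih1, ih2⟩ := blockSum_sound hT hS hw hTn hTd hyD i₀ k hs'
      obtain ⟨ht1, ht2⟩ := termBox_sound hT hS hw hTn hTd hyD ht
      refine ⟨fun j h1 h2 ↦ ?_, fun γ D hγ hD ↦ ?_⟩
      · rcases Nat.lt_succ_iff_lt_or_eq.1 (show j < i₀ + k + 1 by omega) with hj | hj
        · exact ih1 j h1 hj
        · rw [hj]; exact ht1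
      · rw [Finset.sum_range_succ]
        refine MI.mem_add (ih2 γ D (fun j h1 h2 ↦ hγ j h1 (by omega))
          (fun j h1 h2 ↦ hD j h1 (by omega))) ?_
        have h1 := hγ (i₀ + k) (by omega) (by omega)
        exact ht2 _ _ h1.1 h1.2 (hD (i₀ + k) (by omega) (by omega))
    · simp at h

/-- **Soundness of the block checker**: the twisted sign test holds on every bracket of the
block, and `L · 2⁻⁶⁴` bounds the partial sum of the summands from below, for all admissible
`γ_j`, `D_j`. [cite: OdlyzkoTeRiele1985, §4.3 p. 153] -/
theorem checkBlock_sound {p : EMParams} {i₀ len : ℕ} {L : ℤ}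
    (h : checkBlock c p i₀ len L = true) (hw : 0 < c.w) (hTn : 0 < c.Tn) (hTd : 0 < c.Td)
    (hyD : 0 < c.yD) :
    (∀ j, i₀ ≤ j → j < i₀ + len →
        (riemannZeta (1 / 2 + c.a j * I) *
          (starRingEnd ℂ) (riemannZeta (1 / 2 + c.b j * I))).re < 0) ∧
      ∀ (γ : ℕ → ℝ) (D : ℕ → ℂ), (∀ j, i₀ ≤ j → j < i₀ + len → c.a j ≤ γ j ∧ γ j ≤ c.b j) →
        (∀ j, i₀ ≤ j → j < i₀ + len → ‖D j - c.slope j‖ ≤ c.δ j) →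
        (L : ℝ) / 2 ^ 64 ≤ ∑ i ∈ Finset.range len, c.F (γ (i₀ + i)) (D (i₀ + i)) := by
  unfold checkBlock at h
  split at h
  · simp at h
  · rename_i tab htab
    split at h
    · simp at h
    · rename_i s hs
      obtain ⟨hT, hS⟩ : tab.Valid ∧ tab.S = c.S := EMParams.mkTab_spec htab
      have hS0 : 0 < c.S := hS ▸ hT.S_pos
      have hSr : (0 : ℝ) < c.S := by exact_mod_cast hS0
      obtain ⟨h1, h2⟩ := blockSum_sound hT hS hw hTn hTd hyD i₀ len hs
      refine ⟨h1, fun γ D hγ hD ↦ ?_⟩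
      have hm := h2 γ D hγ hD
      have hle : L * (c.S : ℤ) ≤ s.lo * 2 ^ 64 := of_decide_eq_true h
      have hle' : (L : ℝ) * c.S ≤ (s.lo : ℝ) * 2 ^ 64 := by exact_mod_cast hle
      rw [div_le_iff₀ (by positivity)]
      nlinarith [hm.1]

end BlockSound

/-! ## The top edge: a certified piece list along `[x₀, 2] × {T}` -/

/-- `qrot d` applied to a box. [folklore] -/
def rotBox (d : Fin 4) (Z : MC) : MC :=
  match d with
  | 0 => Z
  | 1 => Z.mulNegI
  | 2 => Z.neg
  | 3 => Z.mulI

/-- [folklore] -/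
lemma mem_rotBox {S : ℕ} {z : ℂ} {Z : MC} (hz : MC.mem S z Z) (d : Fin 4) :
    MC.mem S (Literature.Analysis.Complex.qrot d * z) (rotBox d Z) := by
  fin_cases d
  · simpa [rotBox, Literature.Analysis.Complex.qrot] using hz
  · have := MC.mem_mulNegI hz
    simpa [rotBox, Literature.Analysis.Complex.qrot, mul_comm] using this
  · simpa [rotBox, Literature.Analysis.Complex.qrot] using MC.mem_neg hz
  · have := MC.mem_mulI hz
    simpa [rotBox, Literature.Analysis.Complex.qrot, mul_comm] using this

/-- Walk a claimed piece list `(x_i · den⁻¹, d_i)` at height `TI`: each piece `[x_{i-1}, x_i]` must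
have `x_{i-1} ≤ x_i` and `lo (Re (qrot d_i · Z)) > 0` for the enclosure `Z` of `ζ` on the box
`[x_{i-1}, x_i] × TI`. [folklore] -/
def checkPiecesAux (tab : Tables) (TI : MI) (den : ℕ) : ℕ → List (ℕ × Fin 4) → Bool
  | _, [] => true
  | x₀, (x₁, d) :: L =>
    decide (x₀ ≤ x₁) &&
      (match zetaBox tab ⟨MI.span (MI.ofFrac tab.S x₀ den) (MI.ofFrac tab.S x₁ den), TI⟩ with
        | some Z => decide (0 < (rotBox d Z).re.lo)
        | none => false) &&
      checkPiecesAux tab TI den x₁ L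

/-- **Top-edge checker**: tables at scale `S` and the walk along the claimed piece list at
height `T = Tn/Td`, starting from `x₀/den`. [folklore] -/
def checkPieces (S : ℕ) (p : EMParams) (Tn Td den x₀ : ℕ) (L : List (ℕ × Fin 4)) : Bool :=
  match p.mkTab S with
  | none => false
  | some tab => checkPiecesAux tab (MI.ofFrac S Tn Td) den x₀ L

/-- The piece list with real endpoints. [folklore] -/
noncomputable def piecesReal (den : ℕ) (L : List (ℕ × Fin 4)) : List (ℝ × Fin 4) :=
  L.map fun q ↦ ((q.1 : ℝ) / den, q.2)

section PiecesSound

variable {tab : Tables}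

/-- Soundness of the walk. [folklore] -/
theorem checkPiecesAux_sound (hT : tab.Valid) {T : ℝ} (hT0 : T ≠ 0) {TI : MI}
    (hTI : MI.mem tab.S T TI) {den : ℕ} (hden : 0 < den) :
    ∀ (x₀ : ℕ) (L : List (ℕ × Fin 4)), checkPiecesAux tab TI den x₀ L = true →
      Literature.Analysis.Complex.HPieces riemannZeta T ((x₀ : ℝ) / den) (piecesReal den L)
  | x₀, [], _ => by simp [piecesReal]
  | x₀, (x₁, d) :: L, h => by
    simp only [checkPiecesAux, Bool.and_eq_true, decide_eq_true_eq] at h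
    obtain ⟨⟨h01, hZ⟩, hrest⟩ := h
    have hdr : (0 : ℝ) < den := by exact_mod_cast hden
    refine ⟨by gcongr, fun x hx ↦ ?_,
      checkPiecesAux_sound hT hT0 hTI hden x₁ L hrest⟩
    split at hZ
    · rename_i Z hZb
      have hx' : MI.mem tab.S x (MI.span (MI.ofFrac tab.S x₀ den) (MI.ofFrac tab.S x₁ den)) :=
        MI.mem_span (MI.mem_ofFrac tab.S x₀ hden) (MI.mem_ofFrac tab.S x₁ hden)
          (by simpa using hx.1) (by simpa using hx.2)
      have hs : MC.mem tab.S ((x : ℂ) + T * I)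
          ⟨MI.span (MI.ofFrac tab.S x₀ den) (MI.ofFrac tab.S x₁ den), TI⟩ := by
        rw [show (x : ℂ) + T * I = ⟨x, T⟩ from Complex.ext (by simp) (by simp)]
        exact MC.mem_mk' hx' hTI
      have hne : (x : ℂ) + T * I ≠ 1 := fun h1 ↦ hT0 (by simpa using congrArg Complex.im h1)
      have hz := mem_zetaBox hT hs hne hZb
      have := mem_rotBox hz d
      exact MI.pos_of_lo_pos this.1 (of_decide_eq_true hZ)
    · simp at hZ

/-- **Soundness of the top-edge checker.** [folklore] -/
theorem checkPieces_sound {S : ℕ} {p : EMParams} {Tn Td den x₀ : ℕ} {L : List (ℕ × Fin 4)}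
    (h : checkPieces S p Tn Td den x₀ L = true) (hTn : 0 < Tn) (hTd : 0 < Td) (hden : 0 < den) :
    Literature.Analysis.Complex.HPieces riemannZeta ((Tn : ℝ) / Td) ((x₀ : ℝ) / den) (piecesReal den L) := by
  unfold checkPieces at h
  split at h
  · simp at h
  · rename_i tab htab
    obtain ⟨hT, hS⟩ : tab.Valid ∧ tab.S = S := EMParams.mkTab_spec htab
    have hTI : MI.mem tab.S ((Tn : ℝ) / Td) (MI.ofFrac S Tn Td) := by
      rw [hS]
      have := MI.mem_ofFrac S (Tn : ℤ) hTd
      rwa [Int.cast_natCast] at this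
    have hT0 : (Tn : ℝ) / Td ≠ 0 := by positivity
    exact checkPiecesAux_sound hT hT0 hTI hden x₀ L h

/-- The last endpoint of a claimed piece list (labels ignored). [folklore] -/
def lastNat (x₀ : ℕ) : List (ℕ × Fin 4) → ℕ
  | [] => x₀
  | (x₁, _) :: L => lastNat x₁ L

/-- The last label of a claimed piece list. [folklore] -/
def lastDir (d : Fin 4) : List (ℕ × Fin 4) → Fin 4
  | [] => d
  | (_, d₁) :: L => lastDir d₁ L

/-- `piecesLast` of a list with real endpoints. [folklore] -/
lemma piecesLast_piecesReal (den : ℕ) :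
    ∀ (x₀ : ℕ) (L : List (ℕ × Fin 4)),
      Literature.Analysis.Complex.piecesLast ((x₀ : ℝ) / den) (piecesReal den L) = ((lastNat x₀ L : ℕ) : ℝ) / den
  | x₀, [] => by simp [piecesReal, lastNat]
  | x₀, (x₁, d) :: L => by
    rw [show piecesReal den ((x₁, d) :: L) = (((x₁ : ℝ) / den, d) :: piecesReal den L) from rfl,
      Literature.Analysis.Complex.piecesLast_cons, piecesLast_piecesReal den x₁ L, lastNat]

/-- `piecesLastDir` ignores the endpoints. [folklore] -/
lemma piecesLastDir_piecesReal (den : ℕ) :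
    ∀ (d : Fin 4) (L : List (ℕ × Fin 4)),
      Literature.Analysis.Complex.piecesLastDir d (piecesReal den L) = lastDir d L
  | d, [] => by simp [piecesReal, lastDir]
  | d, (x₁, d₁) :: L => by
    rw [show piecesReal den ((x₁, d₁) :: L) = (((x₁ : ℝ) / den, d₁) :: piecesReal den L) from rfl,
      Literature.Analysis.Complex.piecesLastDir_cons, piecesLastDir_piecesReal den d₁ L, lastDir]

/-- The turn count computed on the labels only. [folklore] -/
def turnsNat (d : Fin 4) : List (ℕ × Fin 4) → ℤ
  | [] => 0
  | (_, d') :: L => Literature.Analysis.Complex.qturn d d' + turnsNat d' L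

/-- [folklore] -/
lemma piecesTurns_piecesReal_eq_turnsNat (den : ℕ) :
    ∀ (d : Fin 4) (L : List (ℕ × Fin 4)),
      Literature.Analysis.Complex.piecesTurns d (piecesReal den L) = turnsNat d L
  | d, [] => by simp [piecesReal, turnsNat]
  | d, (x₁, d₁) :: L => by
    rw [show piecesReal den ((x₁, d₁) :: L) = (((x₁ : ℝ) / den, d₁) :: piecesReal den L) from rfl,
      Literature.Analysis.Complex.piecesTurns_cons, piecesTurns_piecesReal_eq_turnsNat den d₁ L, turnsNat]

end PiecesSound

/-! ## The count inequality from the Stirling main term -/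

/-- An enclosure of `log π` at scale `S` from an enclosure `piI` of `π` (by monotonicity of `log`
between the rational endpoints). [folklore] -/
def logPiBox (S K : ℕ) (piI : MI) : Option MI :=
  if 0 < piI.lo then
    match MI.logNat S K piI.lo.toNat, MI.logNat S K piI.hi.toNat, MI.logNat S K S with
    | some A, some B, some LS => some ((MI.span A B).sub LS)
    | _, _, _ => none
  else none

/-- [folklore] -/
theorem mem_logPiBox {S K : ℕ} (hS : 0 < S) {piI Y : MI} (hpi : MI.mem S Real.pi piI)
    (h : logPiBox S K piI = some Y) : MI.mem S (Real.log Real.pi) Y := by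
  unfold logPiBox at h
  split_ifs at h with hlo
  split at h
  · rename_i A B LS hA hB hLS
    simp only [Option.some.injEq] at h
    subst h
    have hSr : (0 : ℝ) < S := by exact_mod_cast hS
    have hA' := MI.mem_logNat hS hA
    have hB' := MI.mem_logNat hS hB
    have hLS' := MI.mem_logNat hS hLS
    have hlo' : (0 : ℝ) < piI.lo := by exact_mod_cast hlo
    have hhi : piI.lo ≤ piI.hi := MI.lo_le_hi hpi
    have e1 : ((piI.lo.toNat : ℕ) : ℝ) = (piI.lo : ℝ) := by
      have := Int.toNat_of_nonneg hlo.le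
      exact_mod_cast this
    have e2 : ((piI.hi.toNat : ℕ) : ℝ) = (piI.hi : ℝ) := by
      have := Int.toNat_of_nonneg (hlo.le.trans hhi)
      exact_mod_cast this
    rw [e1] at hA'; rw [e2] at hB'
    have hpi1 : (piI.lo : ℝ) ≤ Real.pi * S := hpi.1
    have hpi2 : Real.pi * S ≤ (piI.hi : ℝ) := hpi.2
    have key : Real.log Real.pi = Real.log (Real.pi * S) - Real.log S := by
      rw [Real.log_mul Real.pi_pos.ne' hSr.ne']; ring
    rw [key]
    refine MI.mem_sub (MI.mem_span hA' hB' ?_ ?_) hLS'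
    · exact Real.log_le_log hlo' hpi1
    · exact Real.log_le_log (by positivity) hpi2
  · simp at h

/-- **Count checker.** With `M(T) = (T/2) log(T/2π) − T/2 − π/8`, checks
`|M(T)/π + 1 − turns/2 − n| + 2 · stirlingVertRate(¼) / (π T) ≤ ½` in interval arithmetic at scale
`S` (`K` series terms), `T = Tn/Td`. [cite: EdwardsZeta1974, §6.6] -/
def checkCount (S K : ℕ) (Tn Td : ℕ) (turns : ℤ) (n : ℕ) : Bool :=
  match MI.pi S K, MI.logNat S K Tn, MI.logNat S K Td, MI.logTwo S K with
  | some piI, some lTn, some lTd, some l2 =>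
    match logPiBox S K piI with
    | none => false
    | some lpi =>
      let TI := MI.ofFrac S Tn Td
      let LT := ((lTn.sub lTd).sub l2).sub lpi
      let M := ((MI.mul S (TI.divNat 2) LT).sub (TI.divNat 2)).sub (piI.divNat 8)
      let svr := (((MI.ofFrac S 1 6).add (piI.divNat 12)).add (MI.ofFrac S 1 32)).add
        (MI.ofFrac S 1 8)
      match MI.divPos S M piI, MI.divPos S (svr.mulInt 2) (MI.mul S piI TI) with
      | some q, some r =>
        let v := ((q.add (MI.ofInt S 1)).sub (MI.ofFrac S turns 2)).sub (MI.ofInt S n)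
        decide (2 * (v.absHi + r.hi) ≤ (S : ℤ))
      | _, _ => false
  | _, _, _, _ => false

/-- **Soundness of the count checker.** [cite: EdwardsZeta1974, §6.6] -/
theorem checkCount_sound {S K Tn Td : ℕ} {turns : ℤ} {n : ℕ}
    (h : checkCount S K Tn Td turns n = true) (hS : 0 < S) (hTn : 0 < Tn) (hTd : 0 < Td) :
    |((Tn : ℝ) / Td / 2 * Real.log ((Tn : ℝ) / Td / (2 * Real.pi)) - (Tn : ℝ) / Td / 2 -
        Real.pi / 8) / Real.pi + 1 - (turns : ℝ) / 2 - n| +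
      2 * stirlingVertRate (1 / 4) / (Real.pi * ((Tn : ℝ) / Td)) ≤ 1 / 2 := by
  have hSr : (0 : ℝ) < S := by exact_mod_cast hS
  unfold checkCount at h
  split at h
  · rename_i piI lTn lTd l2 hpi hlTn hlTd hl2
    split at h
    · simp at h
    · rename_i lpi hlpi
      simp only at h
      split at h
      · rename_i q r hq hr
        have hle := of_decide_eq_true h
        have hpi' := MI.mem_pi S hpi
        have hlpi' := mem_logPiBox hS hpi' hlpi
        have hlTn' := MI.mem_logNat hS hlTn
        have hlTd' := MI.mem_logNat hS hlTd
        have hl2' := MI.mem_logTwo hS hl2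
        have hTI : MI.mem S ((Tn : ℝ) / Td) (MI.ofFrac S Tn Td) := by
          have := MI.mem_ofFrac S (Tn : ℤ) hTd
          rwa [Int.cast_natCast] at this
        have hTnr : (0 : ℝ) < Tn := by exact_mod_cast hTn
        have hTdr : (0 : ℝ) < Td := by exact_mod_cast hTd
        set T : ℝ := (Tn : ℝ) / Td with hTdef
        have hLT : MI.mem S (Real.log (T / (2 * Real.pi))) (((lTn.sub lTd).sub l2).sub lpi) := by
          have : Real.log (T / (2 * Real.pi)) =
              Real.log Tn - Real.log Td - Real.log 2 - Real.log Real.pi := by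
            rw [hTdef, Real.log_div (by positivity) (by positivity),
              Real.log_div hTnr.ne' hTdr.ne', Real.log_mul (by norm_num) Real.pi_pos.ne']
            ring
          rw [this]
          exact MI.mem_sub (MI.mem_sub (MI.mem_sub hlTn' hlTd') hl2') hlpi'
        have hT2 : MI.mem S (T / 2) ((MI.ofFrac S Tn Td).divNat 2) := by
          exact_mod_cast MI.mem_divNat hTI (n := 2) (by norm_num)
        have hM : MI.mem S (T / 2 * Real.log (T / (2 * Real.pi)) - T / 2 - Real.pi / 8)
            (((MI.mul S ((MI.ofFrac S Tn Td).divNat 2) (((lTn.sub lTd).sub l2).sub lpi)).sub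
              ((MI.ofFrac S Tn Td).divNat 2)).sub (piI.divNat 8)) := by
          refine MI.mem_sub (MI.mem_sub (MI.mem_mul hS hT2 hLT) hT2) ?_
          exact_mod_cast MI.mem_divNat hpi' (n := 8) (by norm_num)
        have hsvr : MI.mem S (stirlingVertRate (1 / 4))
            ((((MI.ofFrac S 1 6).add (piI.divNat 12)).add (MI.ofFrac S 1 32)).add
              (MI.ofFrac S 1 8)) := by
          have e : stirlingVertRate (1 / 4) = (1 : ℤ) / (6 : ℕ) + Real.pi / (12 : ℕ) +
              (1 : ℤ) / (32 : ℕ) + (1 : ℤ) / (8 : ℕ) := by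
            simp only [stirlingVertRate]; push_cast; ring
          rw [e]
          exact MI.mem_add (MI.mem_add (MI.mem_add (MI.mem_ofFrac S 1 (by norm_num))
            (MI.mem_divNat hpi' (by norm_num))) (MI.mem_ofFrac S 1 (by norm_num)))
            (MI.mem_ofFrac S 1 (by norm_num))
        have hq' := MI.mem_divPos hS hq hM hpi'
        have hr' := MI.mem_divPos hS hr (MI.mem_mulInt hsvr 2) (MI.mem_mul hS hpi' hTI)
        have hv : MI.mem S ((T / 2 * Real.log (T / (2 * Real.pi)) - T / 2 - Real.pi / 8) / Real.pi +
            1 - (turns : ℝ) / 2 - n)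
            (((q.add (MI.ofInt S 1)).sub (MI.ofFrac S turns 2)).sub (MI.ofInt S n)) := by
          have h1 := MI.mem_add hq' (MI.mem_ofInt S 1)
          have h2 := MI.mem_sub h1 (MI.mem_ofFrac S turns (q := 2) (by norm_num))
          have h3 := MI.mem_sub h2 (MI.mem_ofInt S n)
          push_cast at h3
          exact h3
        have habs := MI.abs_le_absHi hv
        have hr2 := hr'.2
        have hle' : (2 : ℝ) * ((MI.absHi (((q.add (MI.ofInt S 1)).sub (MI.ofFrac S turns 2)).sub
            (MI.ofInt S n)) : ℝ) + (r.hi : ℝ)) ≤ S := by exact_mod_cast hle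
        have key : (|((T / 2 * Real.log (T / (2 * Real.pi)) - T / 2 - Real.pi / 8) / Real.pi +
            1 - (turns : ℝ) / 2 - n)| + stirlingVertRate (1 / 4) * 2 / (Real.pi * T)) * S ≤
            S / 2 := by
          rw [add_mul]
          linarith
        rw [show 2 * stirlingVertRate (1 / 4) / (Real.pi * T) =
          stirlingVertRate (1 / 4) * 2 / (Real.pi * T) by ring]
        nlinarith
      · simp at h
  · simp at h

/-! ## Shape of the brackets -/

/-- **Shape checker**: `n ≤ size A`, `0 < w`, `8 w ≤ S` (`b_j − a_j ≤ 1/8`), `2 S ≤ A_j`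
(`2 ≤ a_j`), `A_j + w ≤ 2²⁰ S` (`b_j ≤ 2²⁰`), `A_j + w < A_{j+1}` (separation) and
`(A_{n-1} + w) · Td < Tn · S` (`b_j < T`), `0 < Tn`, `0 < Td`, `0 < yD`. [folklore] -/
def checkShape (c : Cert) : Bool :=
  decide (c.n ≤ c.A.size) && decide (0 < c.w) && decide (8 * c.w ≤ c.S) && decide (0 < c.Tn) &&
    decide (0 < c.Td) && decide (0 < c.yD) &&
    (List.range c.n).all (fun j ↦
      decide (2 * (c.S : ℤ) ≤ c.A.getD j 0) &&
      decide (c.A.getD j 0 + c.w ≤ 2 ^ 20 * (c.S : ℤ)) &&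
      decide ((c.A.getD j 0 + c.w) * c.Td < c.Tn * c.S) &&
      (decide (c.n ≤ j + 1) || decide (c.A.getD j 0 + c.w < c.A.getD (j + 1) 0)))

/-- **Soundness of the shape checker.** [folklore] -/
theorem checkShape_sound {c : Cert} (h : checkShape c = true) :
    0 < c.w ∧ 0 < c.Tn ∧ 0 < c.Td ∧ 0 < c.yD ∧ 0 < c.S ∧
    (∀ j, j < c.n → 2 ≤ c.a j) ∧ (∀ j, j < c.n → c.a j < c.b j) ∧
    (∀ j, j < c.n → c.b j ≤ 2 ^ 20) ∧ (∀ j, j < c.n → c.b j - c.a j ≤ 1 / 8) ∧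
    (∀ j k, j < k → k < c.n → c.b j < c.a k) ∧ (∀ j, j < c.n → c.b j < c.T) := by
  simp only [checkShape, Bool.and_eq_true, decide_eq_true_eq, List.all_eq_true, List.mem_range,
    Bool.or_eq_true] at h
  obtain ⟨⟨⟨⟨⟨⟨hn, hw⟩, h8⟩, hTn⟩, hTd⟩, hyD⟩, hall⟩ := h
  have hS : 0 < c.S := by omega
  have hSr : (0 : ℝ) < c.S := by exact_mod_cast hS
  have hTdr : (0 : ℝ) < c.Td := by exact_mod_cast hTd
  have hwr : (0 : ℝ) < c.w := by exact_mod_cast hw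
  -- consecutive separation, iterated
  have hstep : ∀ j, j + 1 < c.n → c.b j < c.a (j + 1) := fun j hj ↦ by
    have h4 := (hall j (by omega)).2
    rcases h4 with h4 | h4
    · exact absurd h4 (by omega)
    · simp only [Cert.a, Cert.b]
      exact div_lt_div_of_pos_right (by exact_mod_cast h4) hSr
  have hab : ∀ j, j < c.n → c.a j < c.b j := fun j _ ↦ by
    simp only [Cert.a, Cert.b]
    push_cast
    exact div_lt_div_of_pos_right (by linarith) hSr
  have hsep : ∀ j k, j < k → k < c.n → c.b j < c.a k := by
    intro j k hjk hk
    induction k with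
    | zero => omega
    | succ k ih =>
      rcases Nat.lt_succ_iff_lt_or_eq.1 hjk with hlt | heq
      · exact lt_trans (ih hlt (by omega)) (lt_trans (hab k (by omega)) (hstep k hk))
      · subst heq; exact hstep j hk
  refine ⟨hw, hTn, hTd, hyD, hS, fun j hj ↦ ?_, hab, fun j hj ↦ ?_, fun j hj ↦ ?_, hsep,
    fun j hj ↦ ?_⟩
  · have h1 := (hall j hj).1.1.1
    simp only [Cert.a]
    rw [le_div_iff₀ hSr]
    exact_mod_cast h1
  · have h2 := (hall j hj).1.1.2
    simp only [Cert.b]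
    rw [div_le_iff₀ hSr]
    exact_mod_cast h2
  · simp only [Cert.a, Cert.b]
    push_cast
    have h8r : (8 : ℝ) * c.w ≤ c.S := by exact_mod_cast h8
    rw [← sub_div, div_le_iff₀ hSr]
    linarith
  · have h3 := (hall j hj).1.2
    simp only [Cert.b, Cert.T]
    have h3r : ((c.A.getD j 0 + c.w : ℤ) : ℝ) * c.Td < (c.Tn : ℝ) * c.S := by exact_mod_cast h3
    rw [div_lt_div_iff₀ hSr hTdr]
    linarith

/-! ## Assembly: the Mertens conjecture is false from checked data -/

/-- The blocks `(i₀, len, L)` tile `[i, n)` consecutively. [folklore] -/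
def blocksChain : ℕ → List (ℕ × ℕ × ℤ) → ℕ → Bool
  | i, [], n => decide (i = n)
  | i, (i₀, len, _) :: bs, n => decide (i₀ = i) && blocksChain (i + len) bs n

section Assembly

variable {c : Cert} {p : EMParams}

/-- A chain starting at `i` ends at `n ≥ i`. [folklore] -/
lemma le_of_blocksChain : ∀ (i : ℕ) (bs : List (ℕ × ℕ × ℤ)) (n : ℕ),
    blocksChain i bs n = true → i ≤ n
  | i, [], n, h => by simp [blocksChain] at h; omega
  | i, (i₀, len, L) :: bs, n, h => by
    simp only [blocksChain, Bool.and_eq_true, decide_eq_true_eq] at h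
    exact le_trans (Nat.le_add_right i len) (le_of_blocksChain _ _ _ h.2)

/-- The blocks of a chain, all checked, give the twisted sign test on `[i, n)` and the sum of the
claimed bounds as a lower bound for the sum of the summands over `[i, n)`. [cite: OdlyzkoTeRiele1985, §4.3 p. 153] -/
theorem blocks_sound (hw : 0 < c.w) (hTn : 0 < c.Tn) (hTd : 0 < c.Td) (hyD : 0 < c.yD) :
    ∀ (i : ℕ) (bs : List (ℕ × ℕ × ℤ)) (n : ℕ), blocksChain i bs n = true →
      (∀ b ∈ bs, checkBlock c p b.1 b.2.1 b.2.2 = true) →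
      (∀ j, i ≤ j → j < n →
        (riemannZeta (1 / 2 + c.a j * I) *
          (starRingEnd ℂ) (riemannZeta (1 / 2 + c.b j * I))).re < 0) ∧
      ∀ (γ : ℕ → ℝ) (D : ℕ → ℂ), (∀ j, i ≤ j → j < n → c.a j ≤ γ j ∧ γ j ≤ c.b j) →
        (∀ j, i ≤ j → j < n → ‖D j - c.slope j‖ ≤ c.δ j) →
        (((bs.map fun b ↦ b.2.2).sum : ℤ) : ℝ) / 2 ^ 64 ≤ ∑ j ∈ Finset.Ico i n, c.F (γ j) (D j)
  | i, [], n, hch, _ => by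
    simp only [blocksChain, decide_eq_true_eq] at hch
    subst hch
    exact ⟨fun j h1 h2 ↦ by omega, fun γ D _ _ ↦ by simp⟩
  | i, (i₀, len, L) :: bs, n, hch, hbs => by
    simp only [blocksChain, Bool.and_eq_true, decide_eq_true_eq] at hch
    obtain ⟨rfl, hch'⟩ := hch
    have hle : i₀ + len ≤ n := le_of_blocksChain _ _ _ hch'
    have hb : checkBlock c p i₀ len L = true := hbs (i₀, len, L) (by simp)
    obtain ⟨h1, h2⟩ := checkBlock_sound hb hw hTn hTd hyD
    obtain ⟨ih1, ih2⟩ := blocks_sound hw hTn hTd hyD (i₀ + len) bs n hch'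
      (fun b hb' ↦ hbs b (by simp [hb']))
    refine ⟨fun j hj1 hj2 ↦ ?_, fun γ D hγ hD ↦ ?_⟩
    · by_cases hj : j < i₀ + len
      · exact h1 j hj1 hj
      · exact ih1 j (by omega) hj2
    · have hsum := h2 γ D (fun j hj1 hj2 ↦ hγ j hj1 (by omega)) (fun j hj1 hj2 ↦ hD j hj1 (by omega))
      have ih := ih2 γ D (fun j hj1 hj2 ↦ hγ j (by omega) hj2) (fun j hj1 hj2 ↦ hD j (by omega) hj2)
      rw [← Finset.sum_Ico_consecutive _ (Nat.le_add_right i₀ len) hle, Finset.sum_Ico_eq_sum_range,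
        show i₀ + len - i₀ = len by omega]
      simp only [List.map_cons, List.sum_cons, Int.cast_add]
      rw [add_div]
      exact add_le_add hsum ih

/-- **The Mertens conjecture is false, from checked data.** All hypotheses are equalities of
closed computable terms with `true` (to be discharged by evaluation) or decidable facts about the
literals: the shape of the brackets, a chain of checked blocks covering `[0, n)` whose claimed
bounds sum to more than `2⁶⁴` (i.e. `Σ_j 2 Re F_y(γ_j) > 1`), a checked piece list along
`[½, 2] × {T}` ending at `2` with label `0`, and the checked count inequality. Conclusion:
`Literature.NumberTheory.LFunctions.not_mertens_conjecture` — via `not_mertens_conjecture_of_twisted_certificate`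
(`MertensConjectureDisproofAssembly.lean`), i.e. via the kernel theorem of
[OdlyzkoTeRiele1985, p. 144] with the Jurkat–Peyerimhoff kernel, the zeros below `T` being
located, counted, simple and on the line by the certificate itself.
[cite: OdlyzkoTeRiele1985, §4 pp. 149–155 with Theorem p. 144 and (1.3) p. 139] -/
theorem not_mertens_conjecture_of_checks {blocks : List (ℕ × ℕ × ℤ)}
    (hshape : checkShape c = true) (hchain : blocksChain 0 blocks c.n = true)
    (hblocks : ∀ b ∈ blocks, checkBlock c p b.1 b.2.1 b.2.2 = true)
    (hsum : (2 : ℤ) ^ 64 < (blocks.map fun b ↦ b.2.2).sum)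
    {Stop : ℕ} {pTop : EMParams} {den x₀ x₁ : ℕ} {d₁ : Fin 4} {L : List (ℕ × Fin 4)}
    (htop : checkPieces Stop pTop c.Tn c.Td den x₀ ((x₁, d₁) :: L) = true)
    (hden : 0 < den) (hx₀ : 2 * x₀ = den) (hlast : lastNat x₁ L = 2 * den)
    (hdir : lastDir d₁ L = 0) {Sc Kc : ℕ} (hSc : 0 < Sc)
    (hcount : checkCount Sc Kc c.Tn c.Td (turnsNat d₁ L) c.n = true) (hT2 : 2 * c.Td ≤ c.Tn) :
    not_mertens_conjecture := by
  obtain ⟨hw, hTn, hTd, hyD, hS, h2, hab, h20, hgap, hsep, hltT⟩ := checkShape_sound hshape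
  have hdr : (0 : ℝ) < den := by exact_mod_cast hden
  have hTdr : (0 : ℝ) < c.Td := by exact_mod_cast hTd
  -- the top edge and the count
  have hP := checkPieces_sound htop hTn hTd hden
  have hx : ((x₀ : ℝ) / den) = 1 / 2 := by
    rw [div_eq_div_iff hdr.ne' two_ne_zero]
    exact_mod_cast (by omega : x₀ * 2 = 1 * den)
  rw [hx] at hP
  change Literature.Analysis.Complex.HPieces riemannZeta c.T (1 / 2) ((((x₁ : ℝ) / den), d₁) :: piecesReal den L)
    at hP
  have hlast' : Literature.Analysis.Complex.piecesLast ((x₁ : ℝ) / den) (piecesReal den L) = 2 := by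
    rw [piecesLast_piecesReal, hlast, div_eq_iff hdr.ne']
    push_cast; ring
  have hdir' : Literature.Analysis.Complex.piecesLastDir d₁ (piecesReal den L) = 0 := by
    rw [piecesLastDir_piecesReal, hdir]
  have hcount' := checkCount_sound hcount hSc hTn hTd
  rw [← piecesTurns_piecesReal_eq_turnsNat den] at hcount'
  have hT2' : (2 : ℝ) ≤ c.T := by
    simp only [Cert.T]; rw [le_div_iff₀ hTdr]; exact_mod_cast hT2
  obtain ⟨htw, hbd⟩ := blocks_sound (p := p) hw hTn hTd hyD 0 blocks c.n hchain hblocks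
  have hsum' : (1 : ℝ) < (((blocks.map fun b ↦ b.2.2).sum : ℤ) : ℝ) / 2 ^ 64 := by
    rw [lt_div_iff₀ (by positivity), one_mul]
    exact_mod_cast hsum
  -- the brackets as `Fin n`-indexed families
  refine not_mertens_conjecture_of_twisted_certificate (n := c.n) (T := c.T)
    (a := fun j ↦ c.a j) (b := fun j ↦ c.b j) (y := c.y)
    (fun j ↦ h2 j j.2) (fun j ↦ hab j j.2) (fun j ↦ h20 j j.2) (fun j ↦ hgap j j.2)
    (fun j k hjk ↦ hsep j k hjk k.2) (fun j ↦ hltT j j.2) (fun j ↦ htw j (Nat.zero_le _) j.2) hT2'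
    hP hlast' hdir' hcount' (fun γ D hγ hD ↦ ?_)
  -- the bound over the brackets
  set γ' : ℕ → ℝ := fun j ↦ if h : j < c.n then γ ⟨j, h⟩ else c.a j with hγ'
  set D' : ℕ → ℂ := fun j ↦ if h : j < c.n then D ⟨j, h⟩ else c.slope j with hD'
  have hb := hbd γ' D' (fun j _ hj ↦ by simp only [hγ', dif_pos hj]; exact hγ ⟨j, hj⟩)
    (fun j _ hj ↦ by simp only [hD', dif_pos hj]; exact hD ⟨j, hj⟩)
  rw [← Finset.range_eq_Ico, Finset.sum_range] at hb
  refine lt_of_lt_of_le hsum' (hb.trans_eq (Finset.sum_congr rfl fun j _ ↦ ?_))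
  simp only [hγ', hD', dif_pos j.2, Cert.F]

/-- **`limsup M(x) x^{-1/2} > 1.06` from checked data** (claimed bounds summing to more than
`1.06 · 2⁶⁴`). [cite: OdlyzkoTeRiele1985, §1 p. 139 and §4 pp. 149–155] -/
theorem odlyzko_te_riele_limsup_of_checks {blocks : List (ℕ × ℕ × ℤ)}
    (hshape : checkShape c = true) (hchain : blocksChain 0 blocks c.n = true)
    (hblocks : ∀ b ∈ blocks, checkBlock c p b.1 b.2.1 b.2.2 = true)
    (hsum : 106 * (2 : ℤ) ^ 64 < 100 * (blocks.map fun b ↦ b.2.2).sum)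
    {Stop : ℕ} {pTop : EMParams} {den x₀ x₁ : ℕ} {d₁ : Fin 4} {L : List (ℕ × Fin 4)}
    (htop : checkPieces Stop pTop c.Tn c.Td den x₀ ((x₁, d₁) :: L) = true)
    (hden : 0 < den) (hx₀ : 2 * x₀ = den) (hlast : lastNat x₁ L = 2 * den)
    (hdir : lastDir d₁ L = 0) {Sc Kc : ℕ} (hSc : 0 < Sc)
    (hcount : checkCount Sc Kc c.Tn c.Td (turnsNat d₁ L) c.n = true) (hT2 : 2 * c.Td ≤ c.Tn) :
    odlyzko_te_riele_limsup := by
  obtain ⟨hw, hTn, hTd, hyD, hS, h2, hab, h20, hgap, hsep, hltT⟩ := checkShape_sound hshape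
  have hdr : (0 : ℝ) < den := by exact_mod_cast hden
  have hTdr : (0 : ℝ) < c.Td := by exact_mod_cast hTd
  have hP := checkPieces_sound htop hTn hTd hden
  have hx : ((x₀ : ℝ) / den) = 1 / 2 := by
    rw [div_eq_div_iff hdr.ne' two_ne_zero]
    exact_mod_cast (by omega : x₀ * 2 = 1 * den)
  rw [hx] at hP
  change Literature.Analysis.Complex.HPieces riemannZeta c.T (1 / 2) ((((x₁ : ℝ) / den), d₁) :: piecesReal den L)
    at hP
  have hlast' : Literature.Analysis.Complex.piecesLast ((x₁ : ℝ) / den) (piecesReal den L) = 2 := by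
    rw [piecesLast_piecesReal, hlast, div_eq_iff hdr.ne']
    push_cast; ring
  have hdir' : Literature.Analysis.Complex.piecesLastDir d₁ (piecesReal den L) = 0 := by
    rw [piecesLastDir_piecesReal, hdir]
  have hcount' := checkCount_sound hcount hSc hTn hTd
  rw [← piecesTurns_piecesReal_eq_turnsNat den] at hcount'
  have hT2' : (2 : ℝ) ≤ c.T := by
    simp only [Cert.T]; rw [le_div_iff₀ hTdr]; exact_mod_cast hT2
  obtain ⟨htw, hbd⟩ := blocks_sound (p := p) hw hTn hTd hyD 0 blocks c.n hchain hblocks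
  have hsum' : (1.06 : ℝ) < (((blocks.map fun b ↦ b.2.2).sum : ℤ) : ℝ) / 2 ^ 64 := by
    rw [lt_div_iff₀ (by positivity)]
    have h' : (106 : ℝ) * 2 ^ 64 < 100 * (((blocks.map fun b ↦ b.2.2).sum : ℤ) : ℝ) := by
      exact_mod_cast hsum
    norm_num at h' ⊢
    linarith
  refine odlyzko_te_riele_limsup_of_twisted_certificate (n := c.n) (T := c.T)
    (a := fun j ↦ c.a j) (b := fun j ↦ c.b j) (y := c.y)
    (fun j ↦ h2 j j.2) (fun j ↦ hab j j.2) (fun j ↦ h20 j j.2) (fun j ↦ hgap j j.2)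
    (fun j k hjk ↦ hsep j k hjk k.2) (fun j ↦ hltT j j.2) (fun j ↦ htw j (Nat.zero_le _) j.2) hT2'
    hP hlast' hdir' hcount' (fun γ D hγ hD ↦ ?_)
  set γ' : ℕ → ℝ := fun j ↦ if h : j < c.n then γ ⟨j, h⟩ else c.a j with hγ'
  set D' : ℕ → ℂ := fun j ↦ if h : j < c.n then D ⟨j, h⟩ else c.slope j with hD'
  have hb := hbd γ' D' (fun j _ hj ↦ by simp only [hγ', dif_pos hj]; exact hγ ⟨j, hj⟩)
    (fun j _ hj ↦ by simp only [hD', dif_pos hj]; exact hD ⟨j, hj⟩)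
  rw [← Finset.range_eq_Ico, Finset.sum_range] at hb
  refine lt_of_lt_of_le hsum' (hb.trans_eq (Finset.sum_congr rfl fun j _ ↦ ?_))
  simp only [hγ', hD', dif_pos j.2, Cert.F]

end Assembly


end Literature.NumberTheory.LFunctions.ZetaNumerics.SparseCert
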